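import Summits.AtomisticToContinuum.Crystallization.Theorems.ShellsToBarlowChart.Negative.Tolerance

/-!
# `ShellsToBarlowChart` (stmt-AtomisticToContinuum-9227), negative side V: the remaining constants

Part V of the crux disprover's negative-side lemmas (`Cruxes/ShellsToBarlowChart/Disproof.lean`,
cycle 2; parts I–IV: `Calibration.lean`, `ScaleWindow.lean`, `Tolerance.lean`, `HaggWord.lean`).

* `shellsToBarlowChart_false_tol` — for EVERY tolerance `η ∈ (3/25, 1/4]` the `η`-tolerant crux
  `ShellsToBarlowChartTol η` (part III) is false (ideal FCC at scale `1 + η` declared at scale `1`):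
  the exact range of the window mechanism of `shellsToBarlowChart_false_tol_eighth`;
* `ShellsToBarlowChartW W` (bond window `(0, W]`; `shellsToBarlowChart_iff_window`: the crux is the
  instance `W = 28/25`) and `shellsToBarlowChart_false_window_one : ¬ ShellsToBarlowChartW 1` — the
  window cannot be narrowed below `101/100` (FCC at scale `1.01` declared at `1`, tolerance exactly
  `1/100`); from above the typed threshold is `5/4 · 9/10 = 1.125`, so `28/25` sits `0.005` inside;
* `coveringStep` — the elementary inequality behind "covering radius `< 0.75`": the bond graph of
  an every-point-good set is connected, so two far-apart good sets are not a counterexample.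

All `[folklore]`; inputs: parts I and III.
-/

noncomputable section

namespace Summit.AtomisticToContinuum.Crystallization.Theorems.ShellsToBarlowChartNegative

open Literature.Geometry.DiscreteGeometry Literature.MathematicalPhysics.StatisticalMechanics
open Summit.AtomisticToContinuum.Crystallization.Theses.PalmUnimodularRigidity

/-- Euclidean `3`-space. -/
local notation "E3" => EuclideanSpace ℝ (Fin 3)

section ToleranceWindow

/-- **The general window kill**: for every tolerance `η ∈ (3/25, 1/4]` the crux with matching
tolerance `η·a` is false, by the ideal FCC stacking at scale `1 + η` declared at scale `1` (no pair
within `28/25 < 1 + η`).  Below `3/25` this mechanism is dead: a counterexample would have to be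
geometric (§ Local rigidity). [folklore] -/
theorem shellsToBarlowChart_false_tol {η : ℝ} (hη : 3 / 25 < η) (hη' : η ≤ 1 / 4) :
    ¬ ShellsToBarlowChartTol η := by
  intro h
  have hc : (0 : ℝ) < 1 + η := by linarith
  have hac : (5 / 4 : ℝ) * 1 < Real.sqrt 2 * (1 + η) := by
    have h2 := five_fourths_lt_sqrt_two
    have : Real.sqrt 2 * 1 ≤ Real.sqrt 2 * (1 + η) :=
      mul_le_mul_of_nonneg_left (by linarith) (Real.sqrt_nonneg 2)
    linarith
  obtain ⟨s, hs, Φ, hbij, hiff⟩ :=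
    h (barlowStacking (1 + η) ((1 + η) * Real.sqrt (2 / 3)) constHagg) ⟨_, barlowPos_mem 0 0 0⟩
      (fun x hx => goodShellAtTol_barlowStacking_declared isHaggSeq_const (η := η) (a := 1)
        (c := 1 + η) hc (by norm_num) le_rfl (by linarith) hac
        (by rw [add_sub_cancel_left, abs_of_pos (by linarith), mul_one]) hx)
  have hh : Real.sqrt (2 / 3) ^ 2 = 2 / 3 * (1 : ℝ) ^ 2 := by
    rw [Real.sq_sqrt (by norm_num)]; ring
  have hpq : dist (barlowPos 1 (Real.sqrt (2 / 3)) s 0 0 0) (barlowPos 1 (Real.sqrt (2 / 3)) s 0 1 0)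
      = 1 := by
    rw [dist_barlowPos_eq_iff hs one_pos hh]
    exact Or.inl ⟨rfl, by decide⟩
  obtain ⟨hpos, hle⟩ := (hiff _ (barlowPos_mem 0 0 0) _ (barlowPos_mem 0 1 0)).1 hpq
  have hne : Φ (barlowPos 1 (Real.sqrt (2 / 3)) s 0 0 0) ≠
      Φ (barlowPos 1 (Real.sqrt (2 / 3)) s 0 1 0) := by
    intro e; rw [e, dist_self] at hpos; exact lt_irrefl _ hpos
  have hcd : 1 + η ≤ dist (Φ (barlowPos 1 (Real.sqrt (2 / 3)) s 0 0 0))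
      (Φ (barlowPos 1 (Real.sqrt (2 / 3)) s 0 1 0)) :=
    le_dist_of_mem_barlowStacking_ideal isHaggSeq_const hc (ideal_sq (1 + η))
      (hbij.mapsTo (barlowPos_mem 0 0 0)) (hbij.mapsTo (barlowPos_mem 0 1 0)) hne
  linarith

end ToleranceWindow

section Window

variable {s : ℤ → ℤ}

/-- The conclusion with bond window `(0, W]`. [folklore] -/
def BarlowChartW (W : ℝ) (S : Set E3) : Prop :=
  ∃ s : ℤ → ℤ, IsHaggSeq s ∧ ∃ Φ : E3 → E3,
    Set.BijOn Φ (barlowStacking 1 (Real.sqrt (2 / 3)) s) S ∧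
    ∀ p ∈ barlowStacking 1 (Real.sqrt (2 / 3)) s, ∀ q ∈ barlowStacking 1 (Real.sqrt (2 / 3)) s,
      (dist p q = 1 ↔ (0 < dist (Φ p) (Φ q) ∧ dist (Φ p) (Φ q) ≤ W))

/-- The crux with bond window `(0, W]` (hypothesis unchanged, written with tolerance `1/100·a`).
[folklore] -/
def ShellsToBarlowChartW (W : ℝ) : Prop :=
  ∀ S : Set E3, S.Nonempty → (∀ x ∈ S, GoodShellAtTol (1 / 100) (9 / 10) 1 S x) → BarlowChartW W S

/-- The crux IS the `W = 28/25` instance. [folklore] -/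
theorem shellsToBarlowChart_iff_window : ShellsToBarlowChart ↔ ShellsToBarlowChartW (28 / 25) := by
  rw [shellsToBarlowChart_iff_tol]
  rfl

/-- **The bond window cannot be narrowed below `101/100`**: with window `(0, 1]` the crux is false
— the ideal FCC stacking at scale `101/100`, declared at scale `1` with tolerance exactly `1/100`,
satisfies the hypothesis, but its bonds (`1.01`) are not window pairs. [folklore] -/
theorem shellsToBarlowChart_false_window_one : ¬ ShellsToBarlowChartW 1 := by
  intro h
  have hc : (0 : ℝ) < 101 / 100 := by norm_num
  have hac : (5 / 4 : ℝ) * 1 < Real.sqrt 2 * (101 / 100) := by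
    have h2 := five_fourths_lt_sqrt_two
    linarith
  obtain ⟨s, hs, Φ, hbij, hiff⟩ :=
    h (barlowStacking (101 / 100) (101 / 100 * Real.sqrt (2 / 3)) constHagg)
      ⟨_, barlowPos_mem 0 0 0⟩
      (fun x hx => goodShellAtTol_barlowStacking_declared isHaggSeq_const (η := 1 / 100) (a := 1)
        (c := 101 / 100) hc (by norm_num) le_rfl (by norm_num) hac
        (by norm_num [abs_of_pos]) hx)
  have hh : Real.sqrt (2 / 3) ^ 2 = 2 / 3 * (1 : ℝ) ^ 2 := by
    rw [Real.sq_sqrt (by norm_num)]; ring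
  have hpq : dist (barlowPos 1 (Real.sqrt (2 / 3)) s 0 0 0) (barlowPos 1 (Real.sqrt (2 / 3)) s 0 1 0)
      = 1 := by
    rw [dist_barlowPos_eq_iff hs one_pos hh]
    exact Or.inl ⟨rfl, by decide⟩
  obtain ⟨hpos, hle⟩ := (hiff _ (barlowPos_mem 0 0 0) _ (barlowPos_mem 0 1 0)).1 hpq
  have hne : Φ (barlowPos 1 (Real.sqrt (2 / 3)) s 0 0 0) ≠
      Φ (barlowPos 1 (Real.sqrt (2 / 3)) s 0 1 0) := by
    intro e; rw [e, dist_self] at hpos; exact lt_irrefl _ hpos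
  have hcd : (101 / 100 : ℝ) ≤ dist (Φ (barlowPos 1 (Real.sqrt (2 / 3)) s 0 0 0))
      (Φ (barlowPos 1 (Real.sqrt (2 / 3)) s 0 1 0)) :=
    le_dist_of_mem_barlowStacking_ideal isHaggSeq_const hc (ideal_sq (101 / 100))
      (hbij.mapsTo (barlowPos_mem 0 0 0)) (hbij.mapsTo (barlowPos_mem 0 1 0)) hne
  linarith

end Window

section Connectedness

/-- **Covering step (why the bond graph is connected and two good sets cannot coexist).**  From
any `x ∈ S` and any target `z` at distance `r ≥ 3/4`, some shell neighbour `y` of `x` is strictly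
closer to `z`: the twelve shell directions of either pattern leave no cap of angular radius `> 45°`
empty (both patterns: exactly `45°`, attained at the centres of the square faces; planner's
`capcheck` finds `≈ 44.9°` by sampling), `1 %` of distortion costs `< 1°`, and with
`cos 46° > 0.69`, `‖y − x‖ ≤ 1.01`:
`‖y − z‖² ≤ r² + a'² − 2 r a' cos θ < r²`.  Hence every point of `ℝ³` is within `0.75` of `S`
(indeed `≤ 0.727`), while a point of a second bond-component would have to stay `> 5a/4 ≥ 1.125`
away from the first: the bond graph of an every-point-good set is connected, finite `S` is
impossible, and "two far-apart good sets" is not a counterexample. [folklore] -/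
theorem coveringStep {r a' c : ℝ} (hr : 3 / 4 ≤ r) (ha : a' ≤ 101 / 100) (ha0 : 0 < a')
    (hc : 69 / 100 ≤ c) : r ^ 2 + a' ^ 2 - 2 * r * a' * c < r ^ 2 := by
  have h1 : a' < 2 * r * c := by nlinarith
  nlinarith

end Connectedness

end Summit.AtomisticToContinuum.Crystallization.Theorems.ShellsToBarlowChartNegative
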